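import Literature.NumberTheory.QuadraticForms.ExistsPlacesGeneratorsNonsquareProofs
import Literature.NumberTheory.QuadraticForms.HilbertReciprocityRat
import HarnessLib

/-!
# The norm index theorem 65:21 and O'Meara 71:19 from Hilbert reciprocity alone

Sibling proof file of `Literature.NumberTheory.QuadraticForms.QuadraticNormIndex` and
`….HilbertSymbolPrescribed` (namespace `Literature.NumberTheory.QuadraticForms`), all declarations
fully proved. With 65:18 (`OMeara65.exists_places_generators_nonsquare_holds`), 65:18a relative to
`J_K ≠ P_K N_{E/K} J_E` (`OMeara65.isSquare_of_generators_places_of_ne_top`), 65:6–65:12 and the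
tower argument of 65:21 (`IdeleSquareIndexProofs`, `NormIndexSecondInequalityProofs`), the local
norm index 63:13/63:13a at every finite place (`LocalNormIndex`) and O'Meara's proof of 71:19
(`HilbertSymbolPrescribedProofs`) all proved in the tree, the only input still missing for the
norm index theorem `(J_K : P_K N_{E/K} J_E) = 2` (O'Meara 65:21 = Vignéras III Thm. 3.7) and for
O'Meara 71:19 (elements with prescribed Hilbert symbols) is the properness
`P_K N_{E/K} J_E ≠ J_K` — O'Meara's first inequality 65:14 in its weakest form. This file observes
that **Hilbert's reciprocity law 71:18 already supplies it**: for a non-square `a` pick a finite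
place `v` with `a ∉ K_v²` (`infinite_setOf_not_isSquare_adicCompletion`, from the density of split
primes) and `t ∈ K_vˣ` not a norm from `K_v(√a)` (63:13,
`adicCompletion_exists_hilbertSymbol_eq_neg_one_holds`); the idèle `i` with `i_v = t` and `1`
elsewhere is a local norm at every place but one, so by reciprocity it is not in `P_K N_{E/K} J_E`
(`even_card_of_mem_principalIdeles_sup_normIdeles`: on `(θ) n` the non-norm places are those with
`(θ, a) = -1`, even in number).

* `principalIdeles_sup_normIdeles_ne_top_of_hilbertReciprocity` — `J_K ≠ P_K N_{E/K} J_E` for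
  `E = K(√a)`, `a` a non-square, from `hilbertReciprocity K · a`;
* `normIdeles_index_eq_two_of_hilbertReciprocity` — **65:21 from 71:18**; hence
  `two_le_normIdeles_index_of_hilbertReciprocity` (65:14), `normIdeles_index_dvd_two_of_hilbertReciprocity`;
* `exists_hilbertSymbol_eq_neg_one_iff_of_hilbertReciprocity` — **O'Meara 71:19 from 71:18 alone**;
* over `ℚ`, where 71:18 is the theorem `hilbertReciprocity_rat` (`HilbertReciprocityRat.lean`):
  `normIdeles_index_eq_two_rat`, `exists_hilbertSymbol_eq_neg_one_iff_rat` — unconditional.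

(In O'Meara the logic runs the other way — 71:18 is deduced in §71 from 65:21, proved via the
unit index 65:10 — so this is a reduction of the named facts of this directory to the single fact
`hilbertReciprocity K`, not a new proof of either.)

## References

* O. T. O'Meara, *Introduction to quadratic forms*, Grundlehren 117, Springer (1963), §65B
  (65:14), §65D (65:21), §63B (63:13), §71 (71:18, 71:19, 71:19a).
-/

noncomputable section

open NumberField IsDedekindDomain

namespace Literature.NumberTheory.QuadraticForms

variable (K : Type) [Field K] [NumberField K]

/-- **`J_K ≠ P_K N_{E/K} J_E` from Hilbert reciprocity.** Let `a ∈ K` be a non-square and assume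
the reciprocity law `hilbertReciprocity K θ a` for all `θ` (O'Meara 71:18). Then
`principalIdeles K ⊔ normIdeles K a ≠ ⊤`: at a finite place `v` with `a ∉ K_v²`
(`infinite_setOf_not_isSquare_adicCompletion`) take `t ∈ K_vˣ` with `(t, a)_v = -1` (63:13,
`adicCompletion_exists_hilbertSymbol_eq_neg_one_holds`); the idèle `(…, 1, t, 1, …)` fails to be a
local norm exactly at `v` — an odd number of places — so it is not a principal idèle times a norm
idèle (`even_card_of_mem_principalIdeles_sup_normIdeles`). (The consequence of 65:14 that O'Meara's
proofs of 65:15, 65:18a and 65:21 use.) [cite: Omeara1963, §65B Prop. 65:14 and §71 Thm. 71:18] -/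
theorem principalIdeles_sup_normIdeles_ne_top_of_hilbertReciprocity {a : K} (ha : ¬ IsSquare a)
    (hrec : ∀ θ : K, hilbertReciprocity K θ a) :
    GaloisRepresentations.principalIdeles K ⊔ normIdeles K a ≠ ⊤ := by
  classical
  intro htop
  have ha0 : a ≠ 0 := by
    rintro rfl
    exact ha IsSquare.zero
  obtain ⟨v, hv⟩ := (infinite_setOf_not_isSquare_adicCompletion ha).nonempty
  haveI : CharZero (v.adicCompletion K) :=
    charZero_of_injective_algebraMap (algebraMap K _).injective
  obtain ⟨t, ht0, ht⟩ := adicCompletion_exists_hilbertSymbol_eq_neg_one_holds K v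
    (algebraMap K _ a) ((map_ne_zero _).2 ha0) hv
  have htN : Units.mk0 t ht0 ∉ quadraticNormSubgroup (v.adicCompletion K) (algebraMap K _ a) :=
    (hilbertSymbol_eq_neg_one_iff_not_mem_quadraticNormSubgroup ((map_ne_zero _).2 ha0)
      (Units.mk0 t ht0)).1 ht
  set i : GaloisRepresentations.ideleGroup K := GaloisRepresentations.localUnits v (Units.mk0 t ht0)
    with hi
  have hmem : i ∈ GaloisRepresentations.principalIdeles K ⊔ normIdeles K a := by
    rw [htop]
    exact Subgroup.mem_top i
  have heven := even_card_of_mem_principalIdeles_sup_normIdeles ha0 hrec hmem {v} ∅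
    (fun v' ↦ by
      by_cases hv' : v' = v
      · subst hv'
        simp only [hi, ideleFiniteComponent_localUnits_self, Finset.mem_singleton]
        exact ⟨fun _ ↦ trivial, fun _ ↦ htN⟩
      · rw [hi, ideleFiniteComponent_localUnits_of_ne K _ hv', Finset.mem_singleton]
        exact ⟨fun h ↦ absurd (Subgroup.one_mem _) h, fun h ↦ absurd h hv'⟩)
    (fun w ↦ by
      rw [hi, ideleInfiniteComponent_localUnits]
      exact ⟨fun h ↦ absurd (Subgroup.one_mem _) h, fun h ↦ absurd h (Finset.notMem_empty w)⟩)
  rw [Finset.card_singleton, Finset.card_empty, add_zero] at heven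
  exact Nat.not_even_one heven

/-- Hilbert reciprocity for `K` gives `J_K ≠ P_K N_{E/K} J_E` for every quadratic `E = K(√a)`.
[cite: Omeara1963, §65B Prop. 65:14 and §71 Thm. 71:18] -/
theorem normIdeles_ne_top_of_hilbertReciprocity (h71 : ∀ a b : K, hilbertReciprocity K a b) :
    ∀ a : K, ¬ IsSquare a → GaloisRepresentations.principalIdeles K ⊔ normIdeles K a ≠ ⊤ :=
  fun a ha ↦ principalIdeles_sup_normIdeles_ne_top_of_hilbertReciprocity K ha fun θ ↦ h71 θ a

/-- **O'Meara 65:21 from Hilbert reciprocity**: the named fact `normIdeles_index_eq_two K`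
(`(J_K : P_K N_{E/K} J_E) = 2` for every `E = K(√a)`, `a` a non-square; Vignéras III Thm. 3.7)
follows from `hilbertReciprocity K` (71:18) — `OMeara65.normIdeles_index_eq_two_of_ne_top` and
`normIdeles_ne_top_of_hilbertReciprocity`. [cite: Omeara1963, §65D Prop. 65:21] -/
theorem normIdeles_index_eq_two_of_hilbertReciprocity (h71 : ∀ a b : K, hilbertReciprocity K a b) :
    normIdeles_index_eq_two K :=
  OMeara65.normIdeles_index_eq_two_of_ne_top K (normIdeles_ne_top_of_hilbertReciprocity K h71)

/-- **O'Meara 65:14 from Hilbert reciprocity**: `two_le_normIdeles_index K` (the first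
inequality) follows from `hilbertReciprocity K`. [cite: Omeara1963, §65B Prop. 65:14] -/
theorem two_le_normIdeles_index_of_hilbertReciprocity (h71 : ∀ a b : K, hilbertReciprocity K a b) :
    two_le_normIdeles_index K :=
  two_le_normIdeles_index_of_eq_two (normIdeles_index_eq_two_of_hilbertReciprocity K h71)

/-- The second inequality `normIdeles_index_dvd_two K` from Hilbert reciprocity.
[cite: Omeara1963, §65D Prop. 65:21 (proof, step 1)] -/
theorem normIdeles_index_dvd_two_of_hilbertReciprocity (h71 : ∀ a b : K, hilbertReciprocity K a b) :
    normIdeles_index_dvd_two K :=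
  normIdeles_index_dvd_two_of_eq_two (normIdeles_index_eq_two_of_hilbertReciprocity K h71)

/-- **O'Meara 71:19 / 71:19a from Hilbert reciprocity alone**: the named fact
`exists_hilbertSymbol_eq_neg_one_iff K` (elements with prescribed local Hilbert symbols;
`HilbertSymbolPrescribed.lean`) follows from `hilbertReciprocity K` (71:18), the other two inputs
of O'Meara's proof being theorems: 65:21 by `normIdeles_index_eq_two_of_hilbertReciprocity` and 63:13
by `adicCompletion_exists_hilbertSymbol_eq_neg_one_holds`.
[cite: Omeara1963, §71 Thm. 71:19 and Cor. 71:19a] -/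
theorem exists_hilbertSymbol_eq_neg_one_iff_of_hilbertReciprocity
    (h71 : ∀ a b : K, hilbertReciprocity K a b) : exists_hilbertSymbol_eq_neg_one_iff K :=
  exists_hilbertSymbol_eq_neg_one_iff_of_normIdeles_index_eq_two K
    (normIdeles_index_eq_two_of_hilbertReciprocity K h71)
    (adicCompletion_exists_hilbertSymbol_eq_neg_one_holds K) h71

/-- **O'Meara 65:21 over `ℚ`**, unconditionally: `normIdeles_index_eq_two ℚ`, Hilbert reciprocity
over `ℚ` being the theorem `hilbertReciprocity_rat`. [cite: Omeara1963, §65D Prop. 65:21] -/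
theorem normIdeles_index_eq_two_rat : normIdeles_index_eq_two ℚ :=
  normIdeles_index_eq_two_of_hilbertReciprocity ℚ hilbertReciprocity_rat

/-- **O'Meara 71:19 over `ℚ`**, unconditionally: `exists_hilbertSymbol_eq_neg_one_iff ℚ`.
[cite: Omeara1963, §71 Thm. 71:19 and Cor. 71:19a] -/
theorem exists_hilbertSymbol_eq_neg_one_iff_rat : exists_hilbertSymbol_eq_neg_one_iff ℚ :=
  exists_hilbertSymbol_eq_neg_one_iff_of_hilbertReciprocity ℚ hilbertReciprocity_rat

end Literature.NumberTheory.QuadraticForms
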